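import Summits.QuantumFields.YangMills.Theorems.FluctuationComparisonRegPrIntLS2BetaCanonicalCurrency
import Summits.QuantumFields.YangMills.Theorems.FluctuationComparisonRegPrIntLHistoryPartition
import Literature.Probability.LatticeModels.PolymerPressure
import HarnessLib

/-!
# LFG IN CANONICAL CURRENCY: `LargeFieldGasRepCan` (LINE g19-1 `largefield_gas.lean` v3 :255–281, R590 (18) item (1)) ⟺ the SAME gas identity read on ONE tree
# function pair `(heightDensityCan F γ hJK univ, heightDensityCan F γ hJK histGood)` with two displayed rows — and its depth-zero body `J = K` OUTRIGHT

Cell `ym3-torus` (HUMAN RULING D-0037: rung R3 = continuum `SU(2)` Yang–Mills on `T³` — NOT `d = 4`, NOT infinite volume, NOT a mass gap, NOT the Clay problem); width seat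
`ym3-torus-px10` (gen 16); helper of the crux `stmt-QuantumFields-20520` `UnitScaleTilt.FluctuationComparisonRegPrIntL` (`--supports … --as helper`, NOT a proof of it); LOCATE
`LOCATE-LFG-px10g16.md` (20520 evidence #41).  THEOREMS ONLY: 0 `def`, 0 `instance`, 0 `notation`, 0 `sorry`, default heartbeats.

CONTEXT.  The organ LFG `LargeFieldGasRepCan` of LINE g19-1 (`Cruxes/FluctuationComparisonRegPrIntL/Lines/largefield_gas.lean` v3 94491e67, its ONE live sorry; ideator `ym-r3-idea-1`
g19, critic #365) reads, at every `J ≤ K`: «for every tower `ν` (`ν K K = Gibbs_K`, `ν K j = (descend j)_* ν K (j+1)`) and every version `ρ` of `ν K J` positive and continuous on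
the window `W_J = {PlaqSmall θ_J}`, given positivity of the canonical all-small density there, `ρ = e^{c}·heightDensityCan^{histGood}·Ξ(w)` ON `W_J` with `w` a V-local Kotecký–Preiss
gas on `W_J` at rate `κ`, pinned size `Ψ J`» — Bałaban's large-field 𝐑-operation output in GAS form ([Balaban1985UV3] (38)–(41); [Balaban1989LargeFieldII] (1.90), (1.97), (1.100)).
As for S2β (✓`…S2BetaCanonicalCurrency`, w5 g19), the tree knows that the tower IS `(D_{J,K})_* Gibbs_K` (✓`tower_eq_map_descendTo`) and that ANY such `ρ` IS
`Z_K⁻¹·heightDensityCan F γ hJK univ` on the window, pointwise (✓`heightDensityCan_univ_eqOn`).  THIS FILE turns that into a NORMAL FORM of LFG: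
  LFG^{can} := LFG's text with the block «`∀ ν` + 2 `ν`-rows + `∀ ρ` + 3 `ρ`-rows» REPLACED by the two rows (r1) `W_J ⊆ Node00.regSet dU (heightDensity F γ hJK univ)`,
  (r2) `∀ U ∈ W_J, 0 < heightDensityCan F γ hJK univ U`, the identity read as `heightDensityCan … univ U = e^{c}·heightDensityCan … histGood U·Ξ(w_U)` on `W_J`; prefix, `Ψ`,
  the `KPGasOn` block and the `hgpos` row BYTE-IDENTICAL (line-local `KPGasOn`∕`gasZ`∕`IsLocalActivity`∕`heightDensityCan` δ-UNFOLDED as KPL-D ✓`…S2BetaKPLogRep.kpLogRep` does).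
* §1 ★★`largeFieldGasRepCan_of_can : ⟨LFG^{can}⟩ → ⟨LFG :255–281 VERBATIM⟩` (same `pS γ₁ κ Ψ w`; `c ↦ c − log Z_K`) · ★`can_of_largeFieldGasRepCan` (converse: feed LFG the tower of
  record and the version `Z_K⁻¹·heightDensityCan … univ` of ✓`canonical_rows`; `c ↦ c + log Z_K`) — together: LFG ⟺ LFG^{can}.
* §2 ★`can_body_self` — LFG^{can}'s body at the cut-off height `J = K` OUTRIGHT, for every family, coupling, thresholds, rate and size `N ≥ 0`: `c = 0`, `w = 0` (the empty gas,
  `Ξ(0) = 1`): on `W_K` both canonical versions ARE `e^{−β_K A}` (`histGood θ K K ⊇ W_K`, ✓`heightDensity_self_eq`, ✓`Node00.canonVersion_eqOn_of_continuousOn`) — the base of the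
  depth induction of the 𝐑-operation ([Balaban1985UV3] (2) p.256: `ρ₀ = e^{−A}`, no large field yet); `largeFieldGasRepCan_body_self` — the same read back on an admissible `(ν, ρ)`.
WHAT IT BUYS (honest; CREDITS NOTHING): a hand on LFG types against ONE function pair per `(J, K)` with two displayed rows and no measure tower; the depth-zero member is a
theorem.  The CONTENT of LFG — depth `K − J ≥ 1`, print's 𝐑-operation (small-field expansion with holes, per-plaquette small factors, resummation into a hard-core gas) — is
NOT touched and NOT proved; LFG∕LFRᶜ∕LFR♯ᶜ∕S2β, the crux 20520, EX∕19200, 19936 are NOT proved; `YM3TorusSU2` NOT proved; the Yang–Mills mass gap (Clay) NOT proved;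
rung R3 = YM₃ on `T³` — NOT `d = 4`, NOT infinite volume, NOT a mass gap.
References: [Balaban1985UV3] T. Bałaban, CMP 102 (1985) 255–275: (2) p.256, (6)–(7) p.257, (38)–(41) p.266; [Balaban1989LargeFieldII] T. Bałaban, CMP 122 (1989) 355–392: (1.90)
p.388, (1.97) p.389, (1.100)–(1.101) p.390; [Balaban1987RG1] CMP 109 (1987) (0.11) p.253, (0.13) p.254; [KoteckyPreiss1986] R. Kotecký, D. Preiss, CMP 103 (1986), Theorem p.492 (1).
-/

set_option autoImplicit false

noncomputable section

open MeasureTheory Filter Topology Set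
open scoped ENNReal
open Literature.Probability.LatticeModels (polyInc polymerPartitionFunction polymerPartitionFunction_zero_mul)
open Literature.MathematicalPhysics.QuantumFieldTheory.Balaban1983to89
open Literature.MathematicalPhysics.QuantumFieldTheory.Balaban1983to89.T3ContinuumYM3Torus
open Literature.MathematicalPhysics.QuantumFieldTheory.Balaban1983to89.T3NestedUnitLaws
open Literature.MathematicalPhysics.QuantumFieldTheory.Balaban1983to89.T3UnitLawDensityEML
open Literature.MathematicalPhysics.QuantumFieldTheory.Balaban1983to89.T3UnitScaleTilt
open Literature.MathematicalPhysics.QuantumFieldTheory.Balaban1983to89.T3TiltDescent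
open Literature.MathematicalPhysics.QuantumFieldTheory.Balaban1983to89.T3PrintedRegularMinimiser
open Literature.MathematicalPhysics.QuantumFieldTheory.Balaban1983to89.T3LevelShift
open Literature.MathematicalPhysics.QuantumFieldTheory.Balaban1983to89.Missing
open Literature.MathematicalPhysics.QuantumFieldTheory.Balaban1983to89.T4Continuum
open scoped Literature.MathematicalPhysics.QuantumFieldTheory.Balaban1983to89.T3OrbitAverage
open Summit.QuantumFields.YangMills.Theorems.FluctuationComparisonRegPrIntLWregGlue (heightDensityCan continuous_boltzmann)
open Summit.QuantumFields.YangMills.Theorems.FluctuationComparisonRegPrIntLOddsLedgerVers (descend_eq_descendTo tower_eq_map_descendTo)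
open Summit.QuantumFields.YangMills.Theorems.FluctuationComparisonRegPrIntLSupTailReduction (heightDensityCan_univ_eqOn)
open Summit.QuantumFields.YangMills.Theorems.FluctuationComparisonRegPrIntLS2BetaCanonicalCurrency (tower_self tower_step canonical_rows version_rows)
open Summit.QuantumFields.YangMills.Theorems.FluctuationComparisonRegPrIntLHistoryPartition (heightDensity_self_eq)

namespace Summit.QuantumFields.YangMills.Theorems.FluctuationComparisonRegPrIntLLargeFieldGasCanonicalCurrency

/-! ## §1 The doors `LFG^{can} → LFG` and `LFG → LFG^{can}` (together: the equivalence) -/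

section Doors

open Classical in
/-- ★★ **LFG `LargeFieldGasRepCan` (LINE g19-1 v3 :255–281, VERBATIM, δ-unfolded) FROM ITS CANONICAL EDITION LFG^{can}** (same `pS γ₁ κ Ψ`, same gas `w`): given an admissible
`(ν, ρ)`, ✓`version_rows` supplies (r1)(r2) and ✓`heightDensityCan_univ_eqOn` gives `heightDensityCan … univ = Z_K·ρ` on the window, so the canonical identity divided by `Z_K`
is LFG's with `c ↦ c − log Z_K`. [cite: Balaban1985UV3, (2) p.256 and (41) p.266; Balaban1989LargeFieldII, (1.90) p.388] -/
theorem largeFieldGasRepCan_of_can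
    (h : ∀ (L : ℕ), ∃ pS : ℝ, ∀ (b₀ p₀ : ℝ), 0 < b₀ → pS ≤ p₀ → 0 < p₀ →
      ∃ γ₁ : ℝ, 0 < γ₁ ∧ ∃ κ : ℝ, 0 < κ ∧ ∀ (F : T3Family) (γ : ℝ), F.L = L → 0 < γ → γ ≤ γ₁ →
        ∃ Ψ : ℕ → ℝ, (∀ J, 0 ≤ Ψ J) ∧ Tendsto (fun J : ℕ => (J : ℝ) * Ψ J) atTop (𝓝 0) ∧
          ∀ (J K : ℕ) (hJK : J ≤ K),
            {U : GaugeField (F.P J) 0 (Matrix.specialUnitaryGroup (Fin 2) ℂ) | PlaqSmall (θBal F.L γ b₀ p₀ J) U} ⊆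
              Node00.regSet (fieldMeasure (F.P J) 0 (Matrix.specialUnitaryGroup (Fin 2) ℂ)) (heightDensity F γ hJK Set.univ) →
            (∀ U : GaugeField (F.P J) 0 (Matrix.specialUnitaryGroup (Fin 2) ℂ), PlaqSmall (θBal F.L γ b₀ p₀ J) U →
                0 < heightDensityCan F γ hJK Set.univ U) →
            (∀ U : GaugeField (F.P J) 0 (Matrix.specialUnitaryGroup (Fin 2) ℂ), PlaqSmall (θBal F.L γ b₀ p₀ J) U →
                0 < heightDensityCan F γ hJK (histGood F ℰp (θBal F.L γ b₀ p₀) K J) U) →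
            ∃ (c : ℝ) (w : GaugeField (F.P J) 0 (Matrix.specialUnitaryGroup (Fin 2) ℂ) → Finset (PBond (F.P J) 0) → ℝ),
              (∃ (wbar a ℓ : Finset (PBond (F.P J) 0) → ℝ),
                (∀ U, w U ∅ = 0) ∧
                (∀ (X : Finset (PBond (F.P J) 0)) (U U' : GaugeField (F.P J) 0 (Matrix.specialUnitaryGroup (Fin 2) ℂ)),
                  (∀ e ∈ X, U e = U' e) → w U X = w U' X) ∧
                (∀ X, 0 ≤ a X) ∧ (∀ X, 0 ≤ ℓ X) ∧
                (∀ U, U ∈ {U : GaugeField (F.P J) 0 (Matrix.specialUnitaryGroup (Fin 2) ℂ) | PlaqSmall (θBal F.L γ b₀ p₀ J) U} →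
                  ∀ X, |w U X| ≤ wbar X) ∧
                (∀ X : Finset (PBond (F.P J) 0), ∀ e ∈ X, ∀ e' ∈ X, (e.src.tdist e'.src : ℝ) ≤ ℓ X) ∧
                (∀ X : Finset (PBond (F.P J) 0), ∑ X' ∈ Finset.univ.filter (fun X' => polyInc X' X),
                    wbar X' * Real.exp (a X' + κ * ℓ X') ≤ a X) ∧
                (∀ e : PBond (F.P J) 0, a {e} ≤ Ψ J)) ∧
              ∀ U : GaugeField (F.P J) 0 (Matrix.specialUnitaryGroup (Fin 2) ℂ), PlaqSmall (θBal F.L γ b₀ p₀ J) U →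
                heightDensityCan F γ hJK Set.univ U =
                  Real.exp c * heightDensityCan F γ hJK (histGood F ℰp (θBal F.L γ b₀ p₀) K J) U *
                    (polymerPartitionFunction polyInc (fun X : Finset (PBond (F.P J) 0) => ((w U X : ℝ) : ℂ)) Finset.univ).re) :
    ∀ (L : ℕ), ∃ pS : ℝ, ∀ (b₀ p₀ : ℝ), 0 < b₀ → pS ≤ p₀ → 0 < p₀ →
      ∃ γ₁ : ℝ, 0 < γ₁ ∧ ∃ κ : ℝ, 0 < κ ∧ ∀ (F : T3Family) (γ : ℝ), F.L = L → 0 < γ → γ ≤ γ₁ →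
        ∃ Ψ : ℕ → ℝ, (∀ J, 0 ≤ Ψ J) ∧ Tendsto (fun J : ℕ => (J : ℝ) * Ψ J) atTop (𝓝 0) ∧
          ∀ (ν : ℕ → (j : ℕ) → Measure (GaugeField (F.P j) 0 (Matrix.specialUnitaryGroup (Fin 2) ℂ))),
            (∀ K, ν K K = T4GenFunBounds.gibbsMeasure (F.P K) ((F.scheme ℰp γ).β K)) →
            (∀ K j, j < K → ν K j = Measure.map (descend F ℰp j) (ν K (j + 1))) →
            ∀ (J K : ℕ) (hJK : J ≤ K) (ρ : GaugeField (F.P J) 0 (Matrix.specialUnitaryGroup (Fin 2) ℂ) → ℝ),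
              (∀ U, PlaqSmall (θBal F.L γ b₀ p₀ J) U → 0 < ρ U) →
              ν K J = (fieldMeasure _ _ _).withDensity (fun U => ENNReal.ofReal (ρ U)) →
              ContinuousOn ρ {U | PlaqSmall (θBal F.L γ b₀ p₀ J) U} →
              (∀ U : GaugeField (F.P J) 0 (Matrix.specialUnitaryGroup (Fin 2) ℂ), PlaqSmall (θBal F.L γ b₀ p₀ J) U →
                  0 < heightDensityCan F γ hJK (histGood F ℰp (θBal F.L γ b₀ p₀) K J) U) →
              ∃ (c : ℝ) (w : GaugeField (F.P J) 0 (Matrix.specialUnitaryGroup (Fin 2) ℂ) → Finset (PBond (F.P J) 0) → ℝ),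
                (∃ (wbar a ℓ : Finset (PBond (F.P J) 0) → ℝ),
                  (∀ U, w U ∅ = 0) ∧
                  (∀ (X : Finset (PBond (F.P J) 0)) (U U' : GaugeField (F.P J) 0 (Matrix.specialUnitaryGroup (Fin 2) ℂ)),
                    (∀ e ∈ X, U e = U' e) → w U X = w U' X) ∧
                  (∀ X, 0 ≤ a X) ∧ (∀ X, 0 ≤ ℓ X) ∧
                  (∀ U, U ∈ {U : GaugeField (F.P J) 0 (Matrix.specialUnitaryGroup (Fin 2) ℂ) | PlaqSmall (θBal F.L γ b₀ p₀ J) U} →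
                    ∀ X, |w U X| ≤ wbar X) ∧
                  (∀ X : Finset (PBond (F.P J) 0), ∀ e ∈ X, ∀ e' ∈ X, (e.src.tdist e'.src : ℝ) ≤ ℓ X) ∧
                  (∀ X : Finset (PBond (F.P J) 0), ∑ X' ∈ Finset.univ.filter (fun X' => polyInc X' X),
                      wbar X' * Real.exp (a X' + κ * ℓ X') ≤ a X) ∧
                  (∀ e : PBond (F.P J) 0, a {e} ≤ Ψ J)) ∧
                ∀ U : GaugeField (F.P J) 0 (Matrix.specialUnitaryGroup (Fin 2) ℂ), PlaqSmall (θBal F.L γ b₀ p₀ J) U →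
                  ρ U = Real.exp c * heightDensityCan F γ hJK (histGood F ℰp (θBal F.L γ b₀ p₀) K J) U *
                    (polymerPartitionFunction polyInc (fun X : Finset (PBond (F.P J) 0) => ((w U X : ℝ) : ℂ)) Finset.univ).re := by
  intro L
  obtain ⟨pS, H⟩ := h L
  refine ⟨pS, fun b₀ p₀ hb hpS hp => ?_⟩
  obtain ⟨γ₁, hγ₁, κ, hκ, H⟩ := H b₀ p₀ hb hpS hp
  refine ⟨γ₁, hγ₁, κ, hκ, fun F γ hFL hγ hγle => ?_⟩
  obtain ⟨Ψ, hΨ0, hΨt, H⟩ := H F γ hFL hγ hγle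
  refine ⟨Ψ, hΨ0, hΨt, fun ν hνK hνd J K hJK ρ hρpos hνρ hρc hgpos => ?_⟩
  obtain ⟨hR, hP, -⟩ := version_rows F b₀ p₀ hJK hγ ν hνK hνd ρ hρpos hνρ hρc
  obtain ⟨c, w, hgas, hid⟩ := H J K hJK hR hP hgpos
  set Z : ℝ := partitionFn (G := Matrix.specialUnitaryGroup (Fin 2) ℂ) (F.P K) ((F.scheme ℰp γ).β K) with hZ
  have hZpos : 0 < Z := partitionFn_pos' _ (F.scheme_β_nonneg ℰp hγ.le K)
  have hlaw : Measure.map (descendTo F ℰp J K hJK) (gibbsK F ℰp γ K) =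
      (fieldMeasure (F.P J) 0 (Matrix.specialUnitaryGroup (Fin 2) ℂ)).withDensity (fun U => ENNReal.ofReal (ρ U)) :=
    (tower_eq_map_descendTo F γ ν hνK hνd hJK).symm.trans hνρ
  have hEq : EqOn (heightDensityCan F γ hJK Set.univ) (fun U => Z * ρ U) {U | PlaqSmall (θBal F.L γ b₀ p₀ J) U} :=
    heightDensityCan_univ_eqOn F b₀ p₀ hJK hγ ρ hρpos hlaw hρc
  refine ⟨c - Real.log Z, w, hgas, fun U hU => ?_⟩
  have key : Z * ρ U = _ := (hEq hU).symm.trans (hid U hU)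
  -- `Z·ρ U = e^{c}·g·Ξ` ⇒ `ρ U = e^{c − log Z}·g·Ξ`
  have hZinv : Real.exp (c - Real.log Z) = Z⁻¹ * Real.exp c := by
    rw [Real.exp_sub, Real.exp_log hZpos, div_eq_inv_mul]
  calc ρ U = Z⁻¹ * (Z * ρ U) := by rw [← mul_assoc, inv_mul_cancel₀ hZpos.ne', one_mul]
    _ = Z⁻¹ * (Real.exp c * heightDensityCan F γ hJK (histGood F ℰp (θBal F.L γ b₀ p₀) K J) U *
          (polymerPartitionFunction polyInc (fun X : Finset (PBond (F.P J) 0) => ((w U X : ℝ) : ℂ)) Finset.univ).re) := by rw [key]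
    _ = Real.exp (c - Real.log Z) * heightDensityCan F γ hJK (histGood F ℰp (θBal F.L γ b₀ p₀) K J) U *
          (polymerPartitionFunction polyInc (fun X : Finset (PBond (F.P J) 0) => ((w U X : ℝ) : ℂ)) Finset.univ).re := by
      rw [hZinv]; ring

open Classical in
/-- ★ **THE CANONICAL EDITION FROM LFG**: feed LFG the tower of record `ν K j := (D_{j,K})_* Gibbs_K` (✓`tower_self`, ✓`tower_step`) and the version
`Z_K⁻¹·heightDensityCan … univ`, admissible under (r1)(r2) by ✓`canonical_rows`; the identity multiplied by `Z_K` is LFG^{can}'s with `c ↦ c + log Z_K`.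
[cite: Balaban1985UV3, (2) p.256 and (41) p.266; Balaban1989LargeFieldII, (1.90) p.388] -/
theorem can_of_largeFieldGasRepCan
    (h : ∀ (L : ℕ), ∃ pS : ℝ, ∀ (b₀ p₀ : ℝ), 0 < b₀ → pS ≤ p₀ → 0 < p₀ →
      ∃ γ₁ : ℝ, 0 < γ₁ ∧ ∃ κ : ℝ, 0 < κ ∧ ∀ (F : T3Family) (γ : ℝ), F.L = L → 0 < γ → γ ≤ γ₁ →
        ∃ Ψ : ℕ → ℝ, (∀ J, 0 ≤ Ψ J) ∧ Tendsto (fun J : ℕ => (J : ℝ) * Ψ J) atTop (𝓝 0) ∧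
          ∀ (ν : ℕ → (j : ℕ) → Measure (GaugeField (F.P j) 0 (Matrix.specialUnitaryGroup (Fin 2) ℂ))),
            (∀ K, ν K K = T4GenFunBounds.gibbsMeasure (F.P K) ((F.scheme ℰp γ).β K)) →
            (∀ K j, j < K → ν K j = Measure.map (descend F ℰp j) (ν K (j + 1))) →
            ∀ (J K : ℕ) (hJK : J ≤ K) (ρ : GaugeField (F.P J) 0 (Matrix.specialUnitaryGroup (Fin 2) ℂ) → ℝ),
              (∀ U, PlaqSmall (θBal F.L γ b₀ p₀ J) U → 0 < ρ U) →
              ν K J = (fieldMeasure _ _ _).withDensity (fun U => ENNReal.ofReal (ρ U)) →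
              ContinuousOn ρ {U | PlaqSmall (θBal F.L γ b₀ p₀ J) U} →
              (∀ U : GaugeField (F.P J) 0 (Matrix.specialUnitaryGroup (Fin 2) ℂ), PlaqSmall (θBal F.L γ b₀ p₀ J) U →
                  0 < heightDensityCan F γ hJK (histGood F ℰp (θBal F.L γ b₀ p₀) K J) U) →
              ∃ (c : ℝ) (w : GaugeField (F.P J) 0 (Matrix.specialUnitaryGroup (Fin 2) ℂ) → Finset (PBond (F.P J) 0) → ℝ),
                (∃ (wbar a ℓ : Finset (PBond (F.P J) 0) → ℝ),
                  (∀ U, w U ∅ = 0) ∧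
                  (∀ (X : Finset (PBond (F.P J) 0)) (U U' : GaugeField (F.P J) 0 (Matrix.specialUnitaryGroup (Fin 2) ℂ)),
                    (∀ e ∈ X, U e = U' e) → w U X = w U' X) ∧
                  (∀ X, 0 ≤ a X) ∧ (∀ X, 0 ≤ ℓ X) ∧
                  (∀ U, U ∈ {U : GaugeField (F.P J) 0 (Matrix.specialUnitaryGroup (Fin 2) ℂ) | PlaqSmall (θBal F.L γ b₀ p₀ J) U} →
                    ∀ X, |w U X| ≤ wbar X) ∧
                  (∀ X : Finset (PBond (F.P J) 0), ∀ e ∈ X, ∀ e' ∈ X, (e.src.tdist e'.src : ℝ) ≤ ℓ X) ∧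
                  (∀ X : Finset (PBond (F.P J) 0), ∑ X' ∈ Finset.univ.filter (fun X' => polyInc X' X),
                      wbar X' * Real.exp (a X' + κ * ℓ X') ≤ a X) ∧
                  (∀ e : PBond (F.P J) 0, a {e} ≤ Ψ J)) ∧
                ∀ U : GaugeField (F.P J) 0 (Matrix.specialUnitaryGroup (Fin 2) ℂ), PlaqSmall (θBal F.L γ b₀ p₀ J) U →
                  ρ U = Real.exp c * heightDensityCan F γ hJK (histGood F ℰp (θBal F.L γ b₀ p₀) K J) U *
                    (polymerPartitionFunction polyInc (fun X : Finset (PBond (F.P J) 0) => ((w U X : ℝ) : ℂ)) Finset.univ).re) :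
    ∀ (L : ℕ), ∃ pS : ℝ, ∀ (b₀ p₀ : ℝ), 0 < b₀ → pS ≤ p₀ → 0 < p₀ →
      ∃ γ₁ : ℝ, 0 < γ₁ ∧ ∃ κ : ℝ, 0 < κ ∧ ∀ (F : T3Family) (γ : ℝ), F.L = L → 0 < γ → γ ≤ γ₁ →
        ∃ Ψ : ℕ → ℝ, (∀ J, 0 ≤ Ψ J) ∧ Tendsto (fun J : ℕ => (J : ℝ) * Ψ J) atTop (𝓝 0) ∧
          ∀ (J K : ℕ) (hJK : J ≤ K),
            {U : GaugeField (F.P J) 0 (Matrix.specialUnitaryGroup (Fin 2) ℂ) | PlaqSmall (θBal F.L γ b₀ p₀ J) U} ⊆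
              Node00.regSet (fieldMeasure (F.P J) 0 (Matrix.specialUnitaryGroup (Fin 2) ℂ)) (heightDensity F γ hJK Set.univ) →
            (∀ U : GaugeField (F.P J) 0 (Matrix.specialUnitaryGroup (Fin 2) ℂ), PlaqSmall (θBal F.L γ b₀ p₀ J) U →
                0 < heightDensityCan F γ hJK Set.univ U) →
            (∀ U : GaugeField (F.P J) 0 (Matrix.specialUnitaryGroup (Fin 2) ℂ), PlaqSmall (θBal F.L γ b₀ p₀ J) U →
                0 < heightDensityCan F γ hJK (histGood F ℰp (θBal F.L γ b₀ p₀) K J) U) →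
            ∃ (c : ℝ) (w : GaugeField (F.P J) 0 (Matrix.specialUnitaryGroup (Fin 2) ℂ) → Finset (PBond (F.P J) 0) → ℝ),
              (∃ (wbar a ℓ : Finset (PBond (F.P J) 0) → ℝ),
                (∀ U, w U ∅ = 0) ∧
                (∀ (X : Finset (PBond (F.P J) 0)) (U U' : GaugeField (F.P J) 0 (Matrix.specialUnitaryGroup (Fin 2) ℂ)),
                  (∀ e ∈ X, U e = U' e) → w U X = w U' X) ∧
                (∀ X, 0 ≤ a X) ∧ (∀ X, 0 ≤ ℓ X) ∧
                (∀ U, U ∈ {U : GaugeField (F.P J) 0 (Matrix.specialUnitaryGroup (Fin 2) ℂ) | PlaqSmall (θBal F.L γ b₀ p₀ J) U} →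
                  ∀ X, |w U X| ≤ wbar X) ∧
                (∀ X : Finset (PBond (F.P J) 0), ∀ e ∈ X, ∀ e' ∈ X, (e.src.tdist e'.src : ℝ) ≤ ℓ X) ∧
                (∀ X : Finset (PBond (F.P J) 0), ∑ X' ∈ Finset.univ.filter (fun X' => polyInc X' X),
                    wbar X' * Real.exp (a X' + κ * ℓ X') ≤ a X) ∧
                (∀ e : PBond (F.P J) 0, a {e} ≤ Ψ J)) ∧
              ∀ U : GaugeField (F.P J) 0 (Matrix.specialUnitaryGroup (Fin 2) ℂ), PlaqSmall (θBal F.L γ b₀ p₀ J) U →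
                heightDensityCan F γ hJK Set.univ U =
                  Real.exp c * heightDensityCan F γ hJK (histGood F ℰp (θBal F.L γ b₀ p₀) K J) U *
                    (polymerPartitionFunction polyInc (fun X : Finset (PBond (F.P J) 0) => ((w U X : ℝ) : ℂ)) Finset.univ).re := by
  intro L
  obtain ⟨pS, H⟩ := h L
  refine ⟨pS, fun b₀ p₀ hb hpS hp => ?_⟩
  obtain ⟨γ₁, hγ₁, κ, hκ, H⟩ := H b₀ p₀ hb hpS hp
  refine ⟨γ₁, hγ₁, κ, hκ, fun F γ hFL hγ hγle => ?_⟩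
  obtain ⟨Ψ, hΨ0, hΨt, H⟩ := H F γ hFL hγ hγle
  refine ⟨Ψ, hΨ0, hΨt, fun J K hJK hR hP hgpos => ?_⟩
  obtain ⟨hpos, hlaw, hcont⟩ := canonical_rows F b₀ p₀ hJK hγ hR hP
  set Z : ℝ := partitionFn (G := Matrix.specialUnitaryGroup (Fin 2) ℂ) (F.P K) ((F.scheme ℰp γ).β K) with hZ
  have hZpos : 0 < Z := partitionFn_pos' _ (F.scheme_β_nonneg ℰp hγ.le K)
  obtain ⟨c, w, hgas, hid⟩ := H (fun (K j : ℕ) => if h : j ≤ K then Measure.map (descendTo F ℰp j K h) (gibbsK F ℰp γ K)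
      else (0 : Measure (GaugeField (F.P j) 0 (Matrix.specialUnitaryGroup (Fin 2) ℂ))))
    (tower_self F γ) (tower_step F γ) J K hJK (fun U => Z⁻¹ * heightDensityCan F γ hJK Set.univ U) hpos
    (by simp only [dif_pos hJK]; exact hlaw) hcont hgpos
  refine ⟨c + Real.log Z, w, hgas, fun U hU => ?_⟩
  have key := hid U hU
  have hexp : Real.exp (c + Real.log Z) = Z * Real.exp c := by
    rw [Real.exp_add, Real.exp_log hZpos, mul_comm]
  calc heightDensityCan F γ hJK Set.univ U = Z * (Z⁻¹ * heightDensityCan F γ hJK Set.univ U) := by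
        rw [← mul_assoc, mul_inv_cancel₀ hZpos.ne', one_mul]
    _ = Z * (Real.exp c * heightDensityCan F γ hJK (histGood F ℰp (θBal F.L γ b₀ p₀) K J) U *
          (polymerPartitionFunction polyInc (fun X : Finset (PBond (F.P J) 0) => ((w U X : ℝ) : ℂ)) Finset.univ).re) := by rw [key]
    _ = Real.exp (c + Real.log Z) * heightDensityCan F γ hJK (histGood F ℰp (θBal F.L γ b₀ p₀) K J) U *
          (polymerPartitionFunction polyInc (fun X : Finset (PBond (F.P J) 0) => ((w U X : ℝ) : ℂ)) Finset.univ).re := by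
      rw [hexp]; ring

end Doors

/-! ## §2 The depth-zero body `J = K` of LFG^{can} — outright: `c = 0`, `w = 0` (the empty gas) -/

section DepthZero

variable (F : T3Family)

/-- On the cut-off-height window `W_K = {PlaqSmall θ_K}` the restricted Boltzmann weight `1_S·e^{−β_K A}` agrees pointwise with `e^{−β_K A}` for every event `S ⊇ W_K` — so
`e^{−β_K A}` is an a.e. version on `W_K` of the diagonal height density `heightDensity F γ hKK S` (✓`heightDensity_self_eq`). [cite: Balaban1985UV3, (2) p.256] -/
theorem boltzmann_ae_eq_heightDensity_self_of_subset (γ b₀ p₀ : ℝ) {K : ℕ} (hKK : K ≤ K)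
    {S : Set (GaugeField (F.P K) 0 (Matrix.specialUnitaryGroup (Fin 2) ℂ))}
    (hS : {V : GaugeField (F.P K) 0 (Matrix.specialUnitaryGroup (Fin 2) ℂ) | PlaqSmall (θBal F.L γ b₀ p₀ K) V} ⊆ S) :
    (boltzmann (F.P K) ((F.scheme ℰp γ).β K) : GaugeField (F.P K) 0 (Matrix.specialUnitaryGroup (Fin 2) ℂ) → ℝ)
      =ᵐ[(fieldMeasure (F.P K) 0 (Matrix.specialUnitaryGroup (Fin 2) ℂ)).restrict
          {V : GaugeField (F.P K) 0 (Matrix.specialUnitaryGroup (Fin 2) ℂ) | PlaqSmall (θBal F.L γ b₀ p₀ K) V}]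
      heightDensity F γ hKK S := by
  refine (ae_restrict_iff' (Node00.isOpen_plaqSmall _).measurableSet).mpr (Eventually.of_forall fun V hV => ?_)
  have e : heightDensity F γ hKK S V = heightDensity F γ (le_refl K) S V := rfl
  rw [e, heightDensity_self_eq, Set.indicator_of_mem (hS hV)]

/-- **BOTH CANONICAL VERSIONS ARE THE BOLTZMANN WEIGHT ON THE DIAGONAL WINDOW**: for every event `S ⊇ W_K`, `heightDensityCan F γ hKK S = e^{−β_K A}` at every point of `W_K`
(`Node00.canonVersion_eqOn_of_continuousOn`: `e^{−β_K A}` is continuous). [cite: Balaban1985UV3, (2) p.256; Balaban1987RG1, (0.13) p.254] -/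
theorem heightDensityCan_self_eqOn_of_subset (γ b₀ p₀ : ℝ) {K : ℕ} (hKK : K ≤ K)
    {S : Set (GaugeField (F.P K) 0 (Matrix.specialUnitaryGroup (Fin 2) ℂ))}
    (hS : {V : GaugeField (F.P K) 0 (Matrix.specialUnitaryGroup (Fin 2) ℂ) | PlaqSmall (θBal F.L γ b₀ p₀ K) V} ⊆ S) :
    EqOn (heightDensityCan F γ hKK S) (boltzmann (F.P K) ((F.scheme ℰp γ).β K))
      {V : GaugeField (F.P K) 0 (Matrix.specialUnitaryGroup (Fin 2) ℂ) | PlaqSmall (θBal F.L γ b₀ p₀ K) V} := by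
  haveI := B12ContinuousTransportInvariance.isOpenPosMeasure_fieldMeasure_SU (N := 2) (F.P K) 0
  exact Node00.canonVersion_eqOn_of_continuousOn (Node00.isOpen_plaqSmall _) (continuous_boltzmann _ _).continuousOn
    (boltzmann_ae_eq_heightDensity_self_of_subset F γ b₀ p₀ hKK hS)

/-- `W_K ⊆ histGood θ K K`: on the diagonal the history event binds only `j = 0` (`Ū⁰ = V`). [cite: Balaban1985UV3, (7) p.257] -/
theorem window_subset_histGood_self (γ b₀ p₀ : ℝ) (K : ℕ) :
    {V : GaugeField (F.P K) 0 (Matrix.specialUnitaryGroup (Fin 2) ℂ) | PlaqSmall (θBal F.L γ b₀ p₀ K) V} ⊆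
      histGood F ℰp (θBal F.L γ b₀ p₀) K K := by
  intro V hV j hj
  have hj0 : j = 0 := by omega
  subst hj0
  rw [Nat.sub_zero]
  exact hV

open Classical in
/-- The empty gas: `Ξ(0) = 1` over all bond polymers of any lattice (lit ✓`polymerPartitionFunction_zero_mul`). [cite: KoteckyPreiss1986, Theorem p.492 (1)] -/
theorem gasZ_zero_eq_one {P : Params} :
    (polymerPartitionFunction polyInc (fun _ : Finset (PBond P 0) => ((0 : ℝ) : ℂ)) Finset.univ).re = 1 := by
  have hfun : (fun _ : Finset (PBond P 0) => ((0 : ℝ) : ℂ)) = fun _ : Finset (PBond P 0) => (0 : ℂ) * (1 : ℂ) := by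
    funext X; simp
  rw [hfun, polymerPartitionFunction_zero_mul]
  simp

open Classical in
/-- The zero activity is a Kotecký–Preiss gas on any window at any rate with any pinned size `N ≥ 0` (majorant `0`, size function `0`, lengths the double sum of source
distances) — the line's sanity instance ✓`kpGasOn_zero`, δ-unfolded. [cite: KoteckyPreiss1986, Theorem p.492 (1)] -/
theorem kpGas_zero {P : Params} (W : Set (GaugeField P 0 (Matrix.specialUnitaryGroup (Fin 2) ℂ))) (κ N : ℝ) (hN : 0 ≤ N) :
    ∃ (wbar a ℓ : Finset (PBond P 0) → ℝ),
      (∀ U : GaugeField P 0 (Matrix.specialUnitaryGroup (Fin 2) ℂ),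
        (fun (_ : GaugeField P 0 (Matrix.specialUnitaryGroup (Fin 2) ℂ)) (_ : Finset (PBond P 0)) => (0 : ℝ)) U ∅ = 0) ∧
      (∀ (X : Finset (PBond P 0)) (U U' : GaugeField P 0 (Matrix.specialUnitaryGroup (Fin 2) ℂ)),
        (∀ e ∈ X, U e = U' e) →
          (fun (_ : GaugeField P 0 (Matrix.specialUnitaryGroup (Fin 2) ℂ)) (_ : Finset (PBond P 0)) => (0 : ℝ)) U X =
            (fun (_ : GaugeField P 0 (Matrix.specialUnitaryGroup (Fin 2) ℂ)) (_ : Finset (PBond P 0)) => (0 : ℝ)) U' X) ∧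
      (∀ X, 0 ≤ a X) ∧ (∀ X, 0 ≤ ℓ X) ∧
      (∀ U, U ∈ W → ∀ X, |(fun (_ : GaugeField P 0 (Matrix.specialUnitaryGroup (Fin 2) ℂ)) (_ : Finset (PBond P 0)) => (0 : ℝ)) U X| ≤ wbar X) ∧
      (∀ X : Finset (PBond P 0), ∀ e ∈ X, ∀ e' ∈ X, (e.src.tdist e'.src : ℝ) ≤ ℓ X) ∧
      (∀ X : Finset (PBond P 0), ∑ X' ∈ Finset.univ.filter (fun X' => polyInc X' X),
          wbar X' * Real.exp (a X' + κ * ℓ X') ≤ a X) ∧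
      (∀ e : PBond P 0, a {e} ≤ N) := by
  refine ⟨fun _ => 0, fun _ => 0, fun X => ∑ e ∈ X, ∑ e' ∈ X, ((e.src.tdist e'.src : ℕ) : ℝ), fun _ => rfl, fun _ _ _ _ => rfl,
    fun _ => le_rfl, ?_, ?_, ?_, ?_, fun _ => hN⟩
  · intro X; exact Finset.sum_nonneg fun e _ => Finset.sum_nonneg fun e' _ => Nat.cast_nonneg _
  · intro U _ X; simp
  · intro X e he e' he'
    have h1 : ((e.src.tdist e'.src : ℕ) : ℝ) ≤ ∑ e'' ∈ X, ((e.src.tdist e''.src : ℕ) : ℝ) :=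
      Finset.single_le_sum (f := fun e'' : PBond P 0 => ((e.src.tdist e''.src : ℕ) : ℝ)) (fun i _ => Nat.cast_nonneg _) he'
    have h2 : ∑ e'' ∈ X, ((e.src.tdist e''.src : ℕ) : ℝ) ≤ ∑ e₁ ∈ X, ∑ e'' ∈ X, ((e₁.src.tdist e''.src : ℕ) : ℝ) :=
      Finset.single_le_sum (f := fun e₁ : PBond P 0 => ∑ e'' ∈ X, ((e₁.src.tdist e''.src : ℕ) : ℝ))
        (fun i _ => Finset.sum_nonneg fun _ _ => Nat.cast_nonneg _) he
    exact h1.trans h2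
  · intro X
    refine (Finset.sum_eq_zero fun X' _ => ?_).le
    exact zero_mul _

open Classical in
/-- ★ **LFG^{can}'s BODY AT THE CUT-OFF HEIGHT `J = K`, OUTRIGHT** — for every family, coupling, thresholds, rate `κ` and size `N ≥ 0`: the full and the all-small canonical densities
COINCIDE on `W_K` (both are `e^{−β_K A}` there), so the identity holds with `c = 0` and the EMPTY gas `w = 0` (`Ξ(0) = 1`, a KP gas of pinned size `≤ N`).  The base of the depth
induction of the 𝐑-operation ([Balaban1985UV3] (1)–(2) p.256: before the first averaging there is no large-field history to expand); NOT a piece of its content.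
[cite: Balaban1985UV3, (1)-(2) p.256 and (41) p.266; KoteckyPreiss1986, Theorem p.492 (1)] -/
theorem can_body_self (γ b₀ p₀ : ℝ) {K : ℕ} (hKK : K ≤ K) (κ N : ℝ) (hN : 0 ≤ N) :
    ∃ (c : ℝ) (w : GaugeField (F.P K) 0 (Matrix.specialUnitaryGroup (Fin 2) ℂ) → Finset (PBond (F.P K) 0) → ℝ),
      (∃ (wbar a ℓ : Finset (PBond (F.P K) 0) → ℝ),
        (∀ U, w U ∅ = 0) ∧
        (∀ (X : Finset (PBond (F.P K) 0)) (U U' : GaugeField (F.P K) 0 (Matrix.specialUnitaryGroup (Fin 2) ℂ)),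
          (∀ e ∈ X, U e = U' e) → w U X = w U' X) ∧
        (∀ X, 0 ≤ a X) ∧ (∀ X, 0 ≤ ℓ X) ∧
        (∀ U, U ∈ {U : GaugeField (F.P K) 0 (Matrix.specialUnitaryGroup (Fin 2) ℂ) | PlaqSmall (θBal F.L γ b₀ p₀ K) U} →
          ∀ X, |w U X| ≤ wbar X) ∧
        (∀ X : Finset (PBond (F.P K) 0), ∀ e ∈ X, ∀ e' ∈ X, (e.src.tdist e'.src : ℝ) ≤ ℓ X) ∧
        (∀ X : Finset (PBond (F.P K) 0), ∑ X' ∈ Finset.univ.filter (fun X' => polyInc X' X),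
            wbar X' * Real.exp (a X' + κ * ℓ X') ≤ a X) ∧
        (∀ e : PBond (F.P K) 0, a {e} ≤ N)) ∧
      ∀ U : GaugeField (F.P K) 0 (Matrix.specialUnitaryGroup (Fin 2) ℂ), PlaqSmall (θBal F.L γ b₀ p₀ K) U →
        heightDensityCan F γ hKK Set.univ U =
          Real.exp c * heightDensityCan F γ hKK (histGood F ℰp (θBal F.L γ b₀ p₀) K K) U *
            (polymerPartitionFunction polyInc (fun X : Finset (PBond (F.P K) 0) => ((w U X : ℝ) : ℂ)) Finset.univ).re := by
  refine ⟨0, fun _ _ => 0, kpGas_zero _ κ N hN, fun U hU => ?_⟩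
  show heightDensityCan F γ hKK Set.univ U =
    Real.exp 0 * heightDensityCan F γ hKK (histGood F ℰp (θBal F.L γ b₀ p₀) K K) U *
      (polymerPartitionFunction polyInc (fun _ : Finset (PBond (F.P K) 0) => ((0 : ℝ) : ℂ)) Finset.univ).re
  rw [gasZ_zero_eq_one, Real.exp_zero, one_mul, mul_one,
    heightDensityCan_self_eqOn_of_subset F γ b₀ p₀ hKK (Set.subset_univ _) hU,
    heightDensityCan_self_eqOn_of_subset F γ b₀ p₀ hKK (window_subset_histGood_self F γ b₀ p₀ K) hU]

open Classical in
/-- **LFG's OWN BODY AT `J = K`, for any admissible `(ν, ρ)`** (the registered organ's depth-zero member, read back through ✓`version_rows` ∕ ✓`heightDensityCan_univ_eqOn`):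
`ρ = e^{−log Z_K}·heightDensityCan^{histGood K K}·Ξ(0)` on `W_K`. [cite: Balaban1985UV3, (1)-(2) p.256 and (41) p.266] -/
theorem largeFieldGasRepCan_body_self {γ : ℝ} (b₀ p₀ : ℝ) (hγ : 0 < γ) {K : ℕ} (hKK : K ≤ K) (κ N : ℝ) (hN : 0 ≤ N)
    (ν : ℕ → (j : ℕ) → Measure (GaugeField (F.P j) 0 (Matrix.specialUnitaryGroup (Fin 2) ℂ)))
    (hνK : ∀ K, ν K K = T4GenFunBounds.gibbsMeasure (F.P K) ((F.scheme ℰp γ).β K))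
    (hνd : ∀ K j, j < K → ν K j = Measure.map (descend F ℰp j) (ν K (j + 1)))
    (ρ : GaugeField (F.P K) 0 (Matrix.specialUnitaryGroup (Fin 2) ℂ) → ℝ)
    (hρpos : ∀ U, PlaqSmall (θBal F.L γ b₀ p₀ K) U → 0 < ρ U)
    (hνρ : ν K K = (fieldMeasure _ _ _).withDensity (fun U => ENNReal.ofReal (ρ U)))
    (hρc : ContinuousOn ρ {U | PlaqSmall (θBal F.L γ b₀ p₀ K) U}) :
    ∃ (c : ℝ) (w : GaugeField (F.P K) 0 (Matrix.specialUnitaryGroup (Fin 2) ℂ) → Finset (PBond (F.P K) 0) → ℝ),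
      (∃ (wbar a ℓ : Finset (PBond (F.P K) 0) → ℝ),
        (∀ U, w U ∅ = 0) ∧
        (∀ (X : Finset (PBond (F.P K) 0)) (U U' : GaugeField (F.P K) 0 (Matrix.specialUnitaryGroup (Fin 2) ℂ)),
          (∀ e ∈ X, U e = U' e) → w U X = w U' X) ∧
        (∀ X, 0 ≤ a X) ∧ (∀ X, 0 ≤ ℓ X) ∧
        (∀ U, U ∈ {U : GaugeField (F.P K) 0 (Matrix.specialUnitaryGroup (Fin 2) ℂ) | PlaqSmall (θBal F.L γ b₀ p₀ K) U} →
          ∀ X, |w U X| ≤ wbar X) ∧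
        (∀ X : Finset (PBond (F.P K) 0), ∀ e ∈ X, ∀ e' ∈ X, (e.src.tdist e'.src : ℝ) ≤ ℓ X) ∧
        (∀ X : Finset (PBond (F.P K) 0), ∑ X' ∈ Finset.univ.filter (fun X' => polyInc X' X),
            wbar X' * Real.exp (a X' + κ * ℓ X') ≤ a X) ∧
        (∀ e : PBond (F.P K) 0, a {e} ≤ N)) ∧
      ∀ U : GaugeField (F.P K) 0 (Matrix.specialUnitaryGroup (Fin 2) ℂ), PlaqSmall (θBal F.L γ b₀ p₀ K) U →
        ρ U = Real.exp c * heightDensityCan F γ hKK (histGood F ℰp (θBal F.L γ b₀ p₀) K K) U *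
          (polymerPartitionFunction polyInc (fun X : Finset (PBond (F.P K) 0) => ((w U X : ℝ) : ℂ)) Finset.univ).re := by
  set Z : ℝ := partitionFn (G := Matrix.specialUnitaryGroup (Fin 2) ℂ) (F.P K) ((F.scheme ℰp γ).β K) with hZ
  have hZpos : 0 < Z := partitionFn_pos' _ (F.scheme_β_nonneg ℰp hγ.le K)
  have hlaw : Measure.map (descendTo F ℰp K K hKK) (gibbsK F ℰp γ K) =
      (fieldMeasure (F.P K) 0 (Matrix.specialUnitaryGroup (Fin 2) ℂ)).withDensity (fun U => ENNReal.ofReal (ρ U)) :=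
    (tower_eq_map_descendTo F γ ν hνK hνd hKK).symm.trans hνρ
  have hEq : EqOn (heightDensityCan F γ hKK Set.univ) (fun U => Z * ρ U) {U | PlaqSmall (θBal F.L γ b₀ p₀ K) U} :=
    heightDensityCan_univ_eqOn F b₀ p₀ hKK hγ ρ hρpos hlaw hρc
  obtain ⟨c, w, hgas, hid⟩ := can_body_self F γ b₀ p₀ hKK κ N hN
  refine ⟨c - Real.log Z, w, hgas, fun U hU => ?_⟩
  have key : Z * ρ U = _ := (hEq hU).symm.trans (hid U hU)
  have hZinv : Real.exp (c - Real.log Z) = Z⁻¹ * Real.exp c := by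
    rw [Real.exp_sub, Real.exp_log hZpos, div_eq_inv_mul]
  calc ρ U = Z⁻¹ * (Z * ρ U) := by rw [← mul_assoc, inv_mul_cancel₀ hZpos.ne', one_mul]
    _ = Z⁻¹ * (Real.exp c * heightDensityCan F γ hKK (histGood F ℰp (θBal F.L γ b₀ p₀) K K) U *
          (polymerPartitionFunction polyInc (fun X : Finset (PBond (F.P K) 0) => ((w U X : ℝ) : ℂ)) Finset.univ).re) := by rw [key]
    _ = Real.exp (c - Real.log Z) * heightDensityCan F γ hKK (histGood F ℰp (θBal F.L γ b₀ p₀) K K) U *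
          (polymerPartitionFunction polyInc (fun X : Finset (PBond (F.P K) 0) => ((w U X : ℝ) : ℂ)) Finset.univ).re := by
      rw [hZinv]; ring

end DepthZero

end Summit.QuantumFields.YangMills.Theorems.FluctuationComparisonRegPrIntLLargeFieldGasCanonicalCurrency

end
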